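import Mathlib

/-!
# Evaluation bound for a bounded double `p`-adic power series on the open unit bidisc

Stub `stub_twoVarEvalNormLe` of the line `lambda-layer-one` of the crux `EdgeDecay`
(`Summit.BirchSwinnertonDyer.BirchSwinnertonDyer.Theses.TangentCone.EdgeDecay`).

Elementary ultrametric analysis. Let `F : ℕ → ℕ → ℚ_[p]` have coefficients bounded in norm by `M`
and let `‖x‖, ‖y‖ < 1`. Then the family `n ↦ F n.1 n.2 * x ^ n.1 * y ^ n.2` on `ℕ × ℕ` is summable
(it is dominated by `M` times a product of two geometric series) and, since every term has norm
`≤ M ‖x‖^n.1 ‖y‖^n.2 ≤ M`, the ultrametric inequality gives `‖∑' n, F n.1 n.2 x^n.1 y^n.2‖ ≤ M`.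
-/

set_option linter.dupNamespace false

namespace Summit.BirchSwinnertonDyer.BirchSwinnertonDyer.Theorems

/-- **Evaluation bound on the open unit bidisc** (elementary ultrametric analysis): if the
coefficients of the double series `F` are bounded in norm by `M` and `‖x‖, ‖y‖ < 1`, then
`n ↦ F n.1 n.2 x^n.1 y^n.2` is summable on `ℕ × ℕ` and its sum has norm `≤ M`. [folklore] -/
theorem stub_twoVarEvalNormLe :
    ∀ (p : ℕ) [Fact p.Prime] (F : ℕ → ℕ → ℚ_[p]) (M : ℝ) (x y : ℚ_[p]), (∀ i j : ℕ, ‖F i j‖ ≤ M) → ‖x‖ < 1 → ‖y‖ < 1 → Summable (fun n : ℕ × ℕ => F n.1 n.2 * x ^ n.1 * y ^ n.2) ∧ ‖∑' n : ℕ × ℕ, F n.1 n.2 * (x) ^ n.1 * (y) ^ n.2‖ ≤ M := by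
  intro p _ F M x y hFM hx hy
  have hM0 : 0 ≤ M := (norm_nonneg _).trans (hFM 0 0)
  -- the general term is dominated by `M` times a product of two geometric terms
  have hterm : ∀ n : ℕ × ℕ, ‖F n.1 n.2 * x ^ n.1 * y ^ n.2‖ ≤ M * (‖x‖ ^ n.1 * ‖y‖ ^ n.2) := by
    intro n
    rw [norm_mul, norm_mul, norm_pow, norm_pow, mul_assoc]
    exact mul_le_mul_of_nonneg_right (hFM _ _) (by positivity)
  -- summability (domination by `M` times a product of two geometric series)
  have hgx : Summable (fun n : ℕ => ‖x‖ ^ n) := summable_geometric_of_lt_one (norm_nonneg _) hx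
  have hgy : Summable (fun n : ℕ => ‖y‖ ^ n) := summable_geometric_of_lt_one (norm_nonneg _) hy
  have hsum : Summable (fun n : ℕ × ℕ => F n.1 n.2 * x ^ n.1 * y ^ n.2) :=
    Summable.of_norm_bounded
      ((hgx.mul_of_nonneg hgy (fun _ => pow_nonneg (norm_nonneg _) _)
        (fun _ => pow_nonneg (norm_nonneg _) _)).mul_left M) hterm
  refine ⟨hsum, ?_⟩
  -- every term has norm `≤ M`, hence so does the sum (ultrametric inequality)
  refine IsUltrametricDist.norm_tsum_le_of_forall_le_of_nonneg hM0 fun n => ?_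
  calc ‖F n.1 n.2 * x ^ n.1 * y ^ n.2‖ ≤ M * (‖x‖ ^ n.1 * ‖y‖ ^ n.2) := hterm n
    _ ≤ M * 1 := by
      refine mul_le_mul_of_nonneg_left ?_ hM0
      exact mul_le_one₀ (pow_le_one₀ (norm_nonneg _) hx.le) (pow_nonneg (norm_nonneg _) _)
        (pow_le_one₀ (norm_nonneg _) hy.le)
    _ = M := mul_one M

end Summit.BirchSwinnertonDyer.BirchSwinnertonDyer.Theorems
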